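/-
Copyright (c) 2026. All rights reserved.
Released under Apache 2.0 license as described in the file LICENSE.
Authors: hodgecm-mathlib cell, prover seat F0P3a-p06 (generation 29).
-/
import Mathlib.RingTheory.LocalRing.Module
import Mathlib.RingTheory.LocalRing.ResidueField.Basic
import HarnessLib

/-!
# Residue bases: lifting a `k`-basis of `I ⊗_A k` to generators of `I` over a local ring

`Literature/Algebra/Module/ResidueBasis.lean` (namespace `Literature.Algebra.Module`).
For a local ring `(A, 𝔪, k)`:

* `exists_residueBasis` : an ideal `I` of finite type has generators `e₁,…,e_L ∈ I` whose
  classes form a `k`-basis of `I ⊗_A k = I/𝔪I` ("minimal basis", [Matsumura1987] Thm. 2.3):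
  every `c ∈ I` is `∑ aₗ eₗ`, and `∑ aₗ eₗ ∈ 𝔪I` forces all `aₗ ∈ 𝔪`.

This is the device of the graded-Nakayama argument of
`Literature/RingTheory/AdicTopology/PowerSeriesTowerPresentation.lean`. THEOREMS ONLY (one
theorem, no definition).

## References
* [Matsumura1987] H. Matsumura, Commutative Ring Theory, CUP, Thm. 2.3.
-/

noncomputable section

open IsLocalRing
open scoped TensorProduct

namespace Literature.Algebra.Module

universe u v w

/-! ### A residue basis of an ideal of a local ring -/

/-- **Residue basis.** An ideal `I` of finite type of a local ring `(A, 𝔪, k)` is generated by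
finitely many elements `e₁,…,e_L ∈ I` whose classes form a `k`-basis of `I ⊗_A k = I/𝔪I`:
every `c ∈ I` is `∑ aₗ eₗ`, and `∑ aₗ eₗ ∈ 𝔪I` forces all `aₗ ∈ 𝔪`.
[cite: Matsumura1987, Thm. 2.3] -/
theorem exists_residueBasis {A : Type u} [CommRing A] [IsLocalRing A] (I : Ideal A) (hI : I.FG) :
    ∃ (L : ℕ) (e : Fin L → A), (∀ l, e l ∈ I) ∧
      (∀ c ∈ I, ∃ a : Fin L → A, c = ∑ l, a l * e l) ∧
      (∀ a : Fin L → A, (∑ l, a l * e l) ∈ maximalIdeal A * I → ∀ l, a l ∈ maximalIdeal A) := by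
  classical
  haveI : Module.Finite A I := Module.Finite.iff_fg.mpr hI
  set k := ResidueField A
  let V := k ⊗[A] I
  let b := Module.finBasis k V
  have hmk : Function.Surjective (TensorProduct.mk A k I 1) :=
    TensorProduct.mk_surjective A I k Ideal.Quotient.mk_surjective
  choose e' he' using fun l => hmk (b l)
  refine ⟨Module.finrank k V, fun l => (e' l : A), fun l => (e' l).2, fun c hc => ?_,
    fun a ha l => ?_⟩
  · -- generation: Nakayama in the form `span_eq_top_of_tmul_eq_basis`
    have hspan : Submodule.span A (Set.range e') = ⊤ :=
      IsLocalRing.span_eq_top_of_tmul_eq_basis (f := e') b fun l => he' l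
    have hc' : (⟨c, hc⟩ : I) ∈ Submodule.span A (Set.range e') := by
      rw [hspan]; exact Submodule.mem_top
    obtain ⟨a, ha⟩ := (Submodule.mem_span_range_iff_exists_fun A).1 hc'
    refine ⟨a, ?_⟩
    have := congrArg (fun x : I => (x : A)) ha
    simpa only [Submodule.coe_sum, Submodule.coe_smul, smul_eq_mul] using this.symm
  · -- independence modulo `𝔪`: `x ∈ 𝔪I ⇒ 1 ⊗ x = 0` in `k ⊗ I`
    have hzero : ∀ x ∈ maximalIdeal A * I, ∃ hx : x ∈ I, (1 : k) ⊗ₜ[A] (⟨x, hx⟩ : I) = 0 := by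
      intro x hxI
      refine Submodule.mul_induction_on hxI (fun μ hμ c hc => ?_) (fun x y hx hy => ?_)
      · refine ⟨I.mul_mem_left μ hc, ?_⟩
        have : (⟨μ * c, I.mul_mem_left μ hc⟩ : I) = μ • (⟨c, hc⟩ : I) := Subtype.ext rfl
        rw [this, TensorProduct.tmul_smul, TensorProduct.smul_tmul', Algebra.smul_def, mul_one,
          show algebraMap A k μ = 0 from (residue_eq_zero_iff μ).2 hμ, TensorProduct.zero_tmul]
      · obtain ⟨hx, ex⟩ := hx
        obtain ⟨hy, ey⟩ := hy
        refine ⟨I.add_mem hx hy, ?_⟩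
        have : (⟨x + y, I.add_mem hx hy⟩ : I) = ⟨x, hx⟩ + ⟨y, hy⟩ := rfl
        rw [this, TensorProduct.tmul_add, ex, ey, add_zero]
    -- the combination `m := ∑ aₗ e'ₗ ∈ I` has `(m : A) = ∑ aₗ eₗ ∈ 𝔪I`, so `∑ (res aₗ) • bₗ = 1 ⊗ m = 0`
    set m : I := ∑ l', a l' • e' l' with hm
    have hmA : (m : A) = ∑ l', a l' * e' l' := by
      simp only [hm, Submodule.coe_sum, Submodule.coe_smul, smul_eq_mul]
    obtain ⟨hmI, hm0⟩ := hzero (m : A) (hmA ▸ ha)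
    have hm0' : (1 : k) ⊗ₜ[A] m = 0 := by
      convert hm0
    have hsum : ∑ l', (residue A (a l')) • b l' = 0 := by
      have : (1 : k) ⊗ₜ[A] m = ∑ l', (residue A (a l')) • b l' := by
        rw [hm, TensorProduct.tmul_sum]
        refine Finset.sum_congr rfl fun l' _ => ?_
        rw [TensorProduct.tmul_smul, ← he' l', ← algebraMap_smul k (a l')]
        rfl
      rw [← this, hm0']
    exact (residue_eq_zero_iff (a l)).1
      (Fintype.linearIndependent_iff.mp b.linearIndependent (fun l' => residue A (a l')) hsum l)

end Literature.Algebra.Module
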